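import Summits.ABC.IUTFork.Cor312TwoPlaceSetting
import Summits.ABC.IUTFork.Repair.EvalHonestCeiling
import Summits.ABC.IUTFork.Cor312LogKummerGlobal
import HarnessLib

/-!
# IUT REPAIR — cross-checker: the TWO-PLACE column «2PL(d⃗)» for the frame-blind volume / region rows (abc-iut-rp-cx, XREAD-6)

Seat abc-iut-rp-cx, rung LADDER-ABC:A2.RP. abc-iut-rp-m4's two-place bed (engine request E4; `Cor312TwoPlaceThm311` p433610,
`Cor312TwoPlaceSetting` p433752): index `twoIndex` (two bad places `v = 0, 1`, `l⋇ = 2`), weighted naive model `twoFull p c`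
(`μ(B_k) = −k·c` at both places), setting `twoSetting p c d` with PLACE-DEPENDENT log-shell inflation of the Θ-images
(`B_{j²−d(v)}` at `(j, v)`), honest q-image `B_1`; at `d = depth = (0, 3)` the typed Statement HOLDS globally while the local portion,
the (xi-f) Licence, Reading R3, S and `GapH3` fail at the deep place `0` (`two_place_witness`). MODEL-SPACE LIMIT #4 of the cx census
(«every bed is one-place») is thereby lifted.

THIS FILE (proof-only; no side taken on [IUTchIII] Cor. 3.12 or on any author; candidates are hypotheses; instantiated ≠ endorsed):
* **the honest ceiling FIRES AT THE FIRST HONEST PACKET** — at `(j = 2, v = 0)` the bed is exactly `j²`-scaled with `qLocal = −c < 0`,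
  so `Repair.EvalHonestCeiling` (p433150) gives at once: RP-X04a `CandExplicit4.H` FAILS (`x04_fails_at_twoPlace`) and RP-C01-VT
  `VolumeTransport` FAILS (`vt_fails_at_twoPlace`) at `2PL(depth)`, whatever happens at the compensating place `1`;
* **the GLOBAL volume row survives**: RP-C01-GVT `GlobalVolumeTransport` HOLDS at `2PL(depth)` (`gvt_holds_at_twoPlace`: label by
  label the two places give `c` and `−5c`, average `−2c = −|log q|`), together with the Statement (`two_statement`) and WITHOUT the
  Licence / S / GapH3 (`two_not_licence`, `two_not_S`, `two_not_gapH3`) — the first multi-place witness separating a label-and-place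
  AVERAGED volume row from every PLACEWISE row; its violated honesty clause is «exact j²-scaling» at the place `1` only
  (`twoPlace_not_scaled_at_one`), so the grade it supports for GVT is SAT⊖[j²-exact @ v = 1], consistent with
  `EvalHonestCeiling.globalVolumeTransport_false_of_bridgeHyps` (which needs exact scaling at EVERY place).
-/

namespace Summit.ABC.IUTFork.Repair.EvalTwoPlaceProfile

open Thm311 Cor312 Cor312Vol Cor312Vol.NaiveProv Cor312Vol.TwoPlace Literature.IUT.LogThetaLattice

variable (p : ℕ) [hp : Fact p.Prime] (c : ℝ)

/-- The log-volume of the `m`-th Kummer image at `(j, v)`: `−(j² − d(v))·c`. [folklore] -/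
theorem two_logvol_thetaRegion (d : twoIndex.VQ → ℕ) (m : ℤ) (j : twoIndex.Label) (vQ : twoIndex.VQ) :
    ((situationW p (fun _ => c) (thetaVec1 (T := twoIndex) p)).D (twoSetting p c d).n).logvol j vQ
        ((twoSetting p c d).thetaRegion m j vQ) =
      -((jsq (T := twoIndex) j - d vQ : ℤ) : ℝ) * c := by
  rw [two_thetaRegion]
  show volW p (fun _ => c) j vQ (pBall p j vQ _) = _
  rw [volW_pBall]

/-- The (Ind3)-Θ-region at `(j, v)` has log-volume `−(j² − d(v))·c`. [folklore] -/
theorem two_logvol_thetaRegion3 (d : twoIndex.VQ → ℕ) (j : twoIndex.Label) (vQ : twoIndex.VQ) :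
    ((situationW p (fun _ => c) (thetaVec1 (T := twoIndex) p)).D (twoSetting p c d).n).logvol j vQ
        ((twoSetting p c d).thetaRegion3 j vQ) =
      -((jsq (T := twoIndex) j - d vQ : ℤ) : ℝ) * c := by
  rw [two_thetaRegion3]
  show volW p (fun _ => c) j vQ (pBall p j vQ _) = _
  rw [volW_pBall]

/-- **At the deep place `v = 0`, label `j = 2`, the bed `2PL(depth)` is exactly `j²`-scaled**: `logvol(thetaRegion3) = 4·qLocal`.
[folklore] -/
theorem twoPlace_scaled_at_zero :
    ((situationW p (fun _ => c) (thetaVec1 (T := twoIndex) p)).D (twoSetting p c depth).n).logvol _ (0 : twoIndex.VQ)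
        ((twoSetting p c depth).thetaRegion3 (Setting.labelSucc (⟨1, by decide⟩ : Fin twoIndex.lstar)) 0) =
      ((((⟨1, by decide⟩ : Fin twoIndex.lstar) : ℕ) + 1 : ℕ) : ℝ) ^ 2 *
        (twoSetting p c depth).qLocal (Setting.labelSucc (⟨1, by decide⟩ : Fin twoIndex.lstar)) 0 := by
  rw [two_logvol_thetaRegion3, two_qLocal]
  have h4 : (jsq (T := twoIndex) (Setting.labelSucc (⟨1, by decide⟩ : Fin twoIndex.lstar)) : ℤ) - (depth 0 : ℤ) = 4 := by
    decide
  rw [h4]; push_cast; ring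

/-- **… but NOT at the compensating place `v = 1`** (`logvol(thetaRegion3) = −c ≠ 4·qLocal = −4c` for `c ≠ 0`): the one honesty
clause `2PL(depth)` violates. [folklore] -/
theorem twoPlace_not_scaled_at_one (hc : c ≠ 0) :
    ((situationW p (fun _ => c) (thetaVec1 (T := twoIndex) p)).D (twoSetting p c depth).n).logvol _ (1 : twoIndex.VQ)
        ((twoSetting p c depth).thetaRegion3 (Setting.labelSucc (⟨1, by decide⟩ : Fin twoIndex.lstar)) 1) ≠
      ((((⟨1, by decide⟩ : Fin twoIndex.lstar) : ℕ) + 1 : ℕ) : ℝ) ^ 2 *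
        (twoSetting p c depth).qLocal (Setting.labelSucc (⟨1, by decide⟩ : Fin twoIndex.lstar)) 1 := by
  rw [two_logvol_thetaRegion3, two_qLocal]
  have h1 : (jsq (T := twoIndex) (Setting.labelSucc (⟨1, by decide⟩ : Fin twoIndex.lstar)) : ℤ) - (depth 1 : ℤ) = 1 := by
    decide
  rw [h1]; push_cast
  intro h
  apply hc
  linarith

/-- **RP-X04a FAILS at `2PL(depth)`** — by the honest ceiling (`EvalHonestCeiling.x04_false_of_bridgeHyps`, p433150) at the
packet `(j = 2, v = 0)`. [folklore] -/
theorem x04_fails_at_twoPlace (hc : 0 < c) :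
    ¬ CandExplicit4.H (twoFull p c).toLatticeSituation (twoSetting p c depth) :=
  EvalHonestCeiling.x04_false_of_bridgeHyps (twoFull p c).toLatticeSituation (twoSetting p c depth)
    (two_bridgeHyps p c depth hc.le) ⟨1, by decide⟩ le_rfl (0 : twoIndex.VQ) (twoPlace_scaled_at_zero p c)
    (by rw [two_qLocal]; linarith)

omit hp in
/-- Every Kummer image of the two-place bed is admissible (a cylinder of the frame). [folklore] -/
theorem twoPlace_thetaRegionsAdm (d : twoIndex.VQ → ℕ) : ThetaRegionsAdm (twoSetting p c d) := fun m i vQ => by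
  rw [two_thetaRegion]
  exact ⟨_, rfl⟩

/-- **RP-C01-VT FAILS at `2PL(depth)`** — by the honest ceiling (`EvalHonestCeiling.volumeTransport_false_of_bridgeHyps`) at
`(j = 2, v = 0)`. [folklore] -/
theorem vt_fails_at_twoPlace (hc : 0 < c) : ¬ VolumeTransport (twoSetting p c depth) :=
  EvalHonestCeiling.volumeTransport_false_of_bridgeHyps (twoFull p c).toLatticeSituation (twoSetting p c depth)
    (two_bridgeHyps p c depth hc.le) (twoPlace_thetaRegionsAdm p c depth) ⟨1, by decide⟩ le_rfl (0 : twoIndex.VQ)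
    (twoPlace_scaled_at_zero p c) (by rw [two_qLocal]; linarith)

/-- **RP-C01-GVT HOLDS at `2PL(depth)`** (with `m ≡ 0`): per label the two places contribute `−(j²−0)c − (j²−3)c = −(2j² − 3)c`,
i.e. `c` at `j = 1` and `−5c` at `j = 2`; the average `−2c` equals `−|log q|`. [folklore] -/
theorem gvt_holds_at_twoPlace : GlobalVolumeTransport (twoSetting p c depth) := by
  refine ⟨fun _ _ => (0 : ℤ), fun _ => Set.toFinite _, ?_⟩
  rw [two_negLogQ]
  have h : (fun i : Fin twoIndex.lstar => ∑ᶠ vQ : twoIndex.VQ,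
      ((situationW p (fun _ => c) (thetaVec1 (T := twoIndex) p)).D (twoSetting p c depth).n).logvol (Setting.labelSucc i) vQ
        ((twoSetting p c depth).thetaRegion ((fun _ _ => (0 : ℤ)) i vQ) (Setting.labelSucc i) vQ)) =
      fun i => -((2 * jsq (T := twoIndex) (Setting.labelSucc (T := twoIndex) i) - 3 : ℤ) : ℝ) * c := by
    funext i
    rw [finsum_eq_sum_of_fintype, Fin.sum_univ_two]
    show ((situationW p (fun _ => c) (thetaVec1 (T := twoIndex) p)).D (twoSetting p c depth).n).logvol _ 0
          ((twoSetting p c depth).thetaRegion 0 _ 0) +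
        ((situationW p (fun _ => c) (thetaVec1 (T := twoIndex) p)).D (twoSetting p c depth).n).logvol _ 1
          ((twoSetting p c depth).thetaRegion 0 _ 1) = _
    rw [two_logvol_thetaRegion, two_logvol_thetaRegion, depth_val.1, depth_val.2]
    push_cast
    ring
  rw [h, pn_two, two_jsq.1, two_jsq.2]
  push_cast
  linarith

/-- **THE 2PL COLUMN (package)** at `d = depth`, `c > 0`: Statement ✓ (rp-m4), GVT ✓, X04a ✗, VT ✗, Licence ✗, and — for every
pin-respecting three-pin reading — GapH3 ✗ (rp-m4); the bed is `j²`-exact at the deep place and not at the compensating one.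
[folklore] -/
theorem twoPlace_column (hc : 0 < c) :
    (twoSetting p c depth).Statement ∧ GlobalVolumeTransport (twoSetting p c depth) ∧
      ¬ CandExplicit4.H (twoFull p c).toLatticeSituation (twoSetting p c depth) ∧
      ¬ VolumeTransport (twoSetting p c depth) ∧ ¬ Thm311ToCor312.Licence (twoSetting p c depth) :=
  ⟨two_statement p c hc, gvt_holds_at_twoPlace p c, x04_fails_at_twoPlace p c hc, vt_fails_at_twoPlace p c hc,
    two_not_licence p c⟩

end Summit.ABC.IUTFork.Repair.EvalTwoPlaceProfile
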